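import Literature.Geometry.Symplectic.CanonicalClassSqAndAdjunctionOfSymplecticFour
import HarnessLib

/-!
# CanonicalClassSqAndAdjunctionOfSymplecticFour — proofs (pointer module)

The statement module `CanonicalClassSqAndAdjunctionOfSymplecticFour.lean` holds two named facts.
Their proof material lives in result-named modules; this `…Proofs.lean` path only points to them
(it imports nothing but the statement module, so either seat may append here without import cycles).

* `thomGysin_complement_surface_four` — **DISCHARGED**:
  `Literature.Geometry.Symplectic.thomGysin_complement_surface_four_holds` in
  `Literature/Geometry/Symplectic/ThomGysinComplementSurfaceFour.lean` (p88403; Bredon 1993 VI.11 via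
  Čech–Alexander–Poincaré duality, tautness and Poincaré duality; import that module to use it).
* `canonicalClass_sq_and_adjunction_of_symplectic_four` — proof bricks (the symplectic orientation of a
  symplectic `4`-manifold and of a symplectic surface, the chart Pfaffian) in
  `Literature/Geometry/Symplectic/SymplecticOrientation.lean` and
  `Literature/Geometry/Symplectic/PfaffianFour.lean` (seat `…canonical-514a82c6a0-0`); the discharge
  `canonicalClass_sq_and_adjunction_of_symplectic_four_holds` has not landed yet and may be appended
  HERE (append protocol: pull this file, keep what is in it, add imports/declarations) or in a further
  result-named module, at that seat's discretion.

## History of this path (collision record, RESOLVED 2026-08-16)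

This path was first created by proposal p86396 (06:43:44Z, seat `…canonical-514a82c6a0-0`, 22
declarations `Literature.Geometry.Symplectic.CanonicalClass.*`) and one minute later unintentionally
replaced wholesale by p86448 (06:44:50Z, seat `…thomGysin-daa92dd31f-0`, which had pulled an empty draft
of the then-nonexistent path at 06:29Z). Both contents have since been re-landed WITHOUT loss at the
result-named paths listed above (the canonical-class bricks at 07:06Z as `SymplecticOrientation.lean` /
`PfaffianFour.lean`, namespace `Literature.Geometry.Symplectic`; the Thom–Gysin discharge at 07:17Z as
`ThomGysinComplementSurfaceFour.lean`). Nothing remains to be restored here: do NOT re-propose the old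
p86396 text at this path (its declarations now exist under `SymplecticOrientation.lean` and would be
duplicates). Lesson recorded for seats: re-pull a `--new` sibling path immediately before proposing it.

## References

* [McDuffSalamon2017] D. McDuff, D. Salamon, Introduction to Symplectic Topology, 3rd ed., OUP 2017
  (source of `canonicalClass_sq_and_adjunction_of_symplectic_four`).
* [Bredon1993] G. E. Bredon, Topology and Geometry, GTM 139, Springer 1993, Ch. VI §11
  (source of `thomGysin_complement_surface_four`).
-/

namespace Literature.Geometry.Symplectic

/-- Placeholder declaration kept for path stability (a module must declare something; nothing
references it and it may be deleted when `canonicalClass_sq_and_adjunction_of_symplectic_four_holds`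
or any other real content is appended to this module). Content: the second projection of the
conjunction of the statement module's two named facts — the second conjunct is in fact a theorem,
`thomGysin_complement_surface_four_holds`. [folklore] -/
theorem CanonicalClass.collisionNotice_placeholder
    (h : canonicalClass_sq_and_adjunction_of_symplectic_four ∧ thomGysin_complement_surface_four) :
    thomGysin_complement_surface_four :=
  h.2

end Literature.Geometry.Symplectic
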